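import Summits.BirchSwinnertonDyer.BirchSwinnertonDyer.Theorems.AdditiveKolyvaginRoadManinFrameResidueProperRTameTwistGamma0
import Mathlib.Data.Nat.ChineseRemainder
import HarnessLib

/-!
# Route `AdditiveKolyvaginRoad`, crux `ManinFrameResidueProperR` (stmt-BirchSwinnertonDyer-20709), line
# `birth`, stub TDS: splitting `γ⁴ = γ₁ γ₂` into adjustable elements of `Γ₀(N)` — `--supports`, helper

Cell `pub/bsd-wall`, seat `bsd-wall-manin-p1` g3. Pure `SL(2, ℤ)` arithmetic, continuing
`…RTameTwistGamma0.lean` (adjustable: `c ≠ 0`, `d ≢ 1 (mod p)`, `d ≢ 1 (mod r)` for odd primes `r ∣ p − 1`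
dividing `c`). §2 `exists_eq_mul_adjustable`: for a prime `p ≥ 5` dividing `N`, every `γ ∈ Γ₀(N)` with
`c ≠ 0` and (`3 ∣ p − 1`, `3 ∣ c` ⟹ `d ≡ 1 (3)`) is a product of two adjustable elements (`γ₂ = (u, −v; c, d₂)`
with `d₂` a large prime in prescribed classes, Dirichlet + CRT). §3 `three_dvd_pow_four_entry`:
`3 ∣ (γ⁴)₁₀ ⟹ (γ⁴)₁₁ ≡ 1 (3)` for all `γ ∈ SL(2, ℤ)` (a check in `SL₂(𝔽₃)`), so `γ⁴` always meets the
side condition. Everything proved; no definition.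
-/

set_option autoImplicit false
set_option linter.dupNamespace false

noncomputable section

open scoped MatrixGroups Classical

open CongruenceSubgroup Matrix

namespace Summit.BirchSwinnertonDyer.BirchSwinnertonDyer.Theorems.ManinFrameResidueProperRTameTwist

/-! ### §2 Splitting `γ = γ₁ γ₂` into adjustable elements -/

section Splitting

variable {N : ℕ} {p : ℕ}

/-- An odd prime does not divide `1` or `2`; a prime `≥ 5` does not divide `3` either (plumbing, in
`ℤ`). [folklore] -/
theorem not_intCast_dvd_of_lt {q m : ℕ} (hm : 0 < m) (hmq : m < q) : ¬ (q : ℤ) ∣ (m : ℤ) := by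
  intro h
  exact absurd (Nat.le_of_dvd hm (Int.natCast_dvd_natCast.mp h)) (not_le.mpr hmq)

/-- **Residue choice.** For an odd prime `q`, an integer `d`, and the side condition
(`q = 3` ⟹ `3 ∣ d − 1`) when `q ∣ c`: some `x ∈ {1, 2, 3}` has `q ∤ x`, `q ∤ x − d`, and
`q ∣ c ⟹ q ∤ x − 1`. [folklore] -/
theorem exists_residue (q : ℕ) (hq : q.Prime) (hq2 : q ≠ 2) (c d : ℤ)
    (h3 : q = 3 → (q : ℤ) ∣ c → (q : ℤ) ∣ d - 1) :
    ∃ x : ℕ, ¬ (q : ℤ) ∣ x ∧ ¬ (q : ℤ) ∣ (x : ℤ) - d ∧ ((q : ℤ) ∣ c → ¬ (q : ℤ) ∣ (x : ℤ) - 1) := by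
  have hq3 : 3 ≤ q := by
    have := hq.two_le
    omega
  have hn1 : ¬ (q : ℤ) ∣ (1 : ℕ) := not_intCast_dvd_of_lt one_pos (by omega)
  have hn2 : ¬ (q : ℤ) ∣ (2 : ℕ) := not_intCast_dvd_of_lt two_pos (by omega)
  by_cases hqc : (q : ℤ) ∣ c
  · by_cases hq3' : q = 3
    · -- `x = 2`, using `3 ∣ d − 1`
      have hd := h3 hq3' hqc
      refine ⟨2, hn2, fun h ↦ hn1 ?_, fun _ h ↦ hn1 ?_⟩
      · have : ((1 : ℕ) : ℤ) = ((2 : ℕ) : ℤ) - d + (d - 1) := by omega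
        rw [this]; exact dvd_add h hd
      · simpa using h
    · -- `q ≥ 5`: `x = 2` or `x = 3`
      have hq5 : 5 ≤ q := by
        by_contra hlt
        rw [not_le] at hlt
        interval_cases q
        · exact hq3' rfl
        · exact absurd hq (by decide)
      have hn3 : ¬ (q : ℤ) ∣ (3 : ℕ) := not_intCast_dvd_of_lt three_pos (by omega)
      by_cases h2d : (q : ℤ) ∣ ((2 : ℕ) : ℤ) - d
      · refine ⟨3, hn3, fun h ↦ hn1 ?_, fun _ h ↦ hn2 ?_⟩
        · have : ((1 : ℕ) : ℤ) = (((3 : ℕ) : ℤ) - d) - (((2 : ℕ) : ℤ) - d) := by omega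
          rw [this]; exact dvd_sub h h2d
        · have : ((2 : ℕ) : ℤ) = ((3 : ℕ) : ℤ) - 1 := by omega
          rw [this]; exact h
      · refine ⟨2, hn2, h2d, fun _ h ↦ hn1 ?_⟩
        have : ((1 : ℕ) : ℤ) = ((2 : ℕ) : ℤ) - 1 := by omega
        rw [this]; exact h
  · by_cases h1d : (q : ℤ) ∣ ((1 : ℕ) : ℤ) - d
    · refine ⟨2, hn2, fun h ↦ hn1 ?_, fun h ↦ absurd h hqc⟩
      have : ((1 : ℕ) : ℤ) = (((2 : ℕ) : ℤ) - d) - (((1 : ℕ) : ℤ) - d) := by omega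
      rw [this]; exact dvd_sub h h1d
    · exact ⟨1, hn1, h1d, fun h ↦ absurd h hqc⟩

/-- **Splitting into adjustable factors.** For a prime `p ≥ 5` dividing `N` and `γ = (a b; c d) ∈ Γ₀(N)`
with `c ≠ 0` and (`3 ∣ p − 1`, `3 ∣ c` ⟹ `d ≡ 1 (3)`): `γ = γ₁ γ₂` with `γ₁, γ₂ ∈ Γ₀(N)` adjustable.
`γ₂ = (u, −v; c, d₂)`, `d₂ > |c|` a prime (Dirichlet) in classes `∉ {0, d}` (and `∉ {1}` when `q ∣ c`)
modulo `p` and the odd primes of `p − 1`, `u d₂ + v c = 1`; `γ₁ = γ γ₂⁻¹` has `c₁ = c (d₂ − d)` and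
`d₁ d₂ − d = c v (d₂ − d)`. [folklore] -/
theorem exists_eq_mul_adjustable (hp : p.Prime) (hp5 : 5 ≤ p) (hpN : p ∣ N) (γ : Gamma0 N)
    (hc : (γ : SL(2, ℤ)) 1 0 ≠ 0)
    (h3 : 3 ∣ p - 1 → (3 : ℤ) ∣ (γ : SL(2, ℤ)) 1 0 → (3 : ℤ) ∣ (γ : SL(2, ℤ)) 1 1 - 1) :
    ∃ γ₁ γ₂ : Gamma0 N, γ = γ₁ * γ₂ ∧
      ((γ₁ : SL(2, ℤ)) 1 0 ≠ 0 ∧ ¬ (p : ℤ) ∣ (γ₁ : SL(2, ℤ)) 1 1 - 1 ∧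
        ∀ r : ℕ, r.Prime → r ≠ 2 → r ∣ p - 1 → (r : ℤ) ∣ (γ₁ : SL(2, ℤ)) 1 0 →
          ¬ (r : ℤ) ∣ (γ₁ : SL(2, ℤ)) 1 1 - 1) ∧
      ((γ₂ : SL(2, ℤ)) 1 0 ≠ 0 ∧ ¬ (p : ℤ) ∣ (γ₂ : SL(2, ℤ)) 1 1 - 1 ∧
        ∀ r : ℕ, r.Prime → r ≠ 2 → r ∣ p - 1 → (r : ℤ) ∣ (γ₂ : SL(2, ℤ)) 1 0 →
          ¬ (r : ℤ) ∣ (γ₂ : SL(2, ℤ)) 1 1 - 1) := by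
  have hp2 : p ≠ 2 := by omega
  have hpc : (p : ℤ) ∣ (γ : SL(2, ℤ)) 1 0 :=
    (Int.natCast_dvd_natCast.mpr hpN).trans (natCast_dvd_entry10 γ)
  -- the primes at which residues are prescribed
  set S : Finset ℕ := insert p ((p - 1).primeFactors.erase 2) with hSdef
  have hSprime : ∀ q ∈ S, q.Prime ∧ q ≠ 2 := by
    intro q hq
    rcases Finset.mem_insert.mp hq with rfl | hq
    · exact ⟨hp, hp2⟩
    · exact ⟨Nat.prime_of_mem_primeFactors (Finset.mem_of_mem_erase hq), Finset.ne_of_mem_erase hq⟩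
  have hS3 : ∀ q ∈ S, q = 3 → (q : ℤ) ∣ (γ : SL(2, ℤ)) 1 0 → (q : ℤ) ∣ (γ : SL(2, ℤ)) 1 1 - 1 := by
    intro q hq hq3 hqc
    subst hq3
    rcases Finset.mem_insert.mp hq with h | h
    · omega
    · exact h3 (Nat.dvd_of_mem_primeFactors (Finset.mem_of_mem_erase h)) hqc
  -- residues and CRT
  have hres : ∀ q ∈ S, ∃ x : ℕ, ¬ (q : ℤ) ∣ x ∧ ¬ (q : ℤ) ∣ (x : ℤ) - (γ : SL(2, ℤ)) 1 1 ∧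
      ((q : ℤ) ∣ (γ : SL(2, ℤ)) 1 0 → ¬ (q : ℤ) ∣ (x : ℤ) - 1) := fun q hq ↦
    exists_residue q (hSprime q hq).1 (hSprime q hq).2 _ _ (hS3 q hq)
  let xr : ℕ → ℕ := fun q ↦ if hq : q ∈ S then Classical.choose (hres q hq) else 0
  have hxr : ∀ q ∈ S, ¬ (q : ℤ) ∣ xr q ∧ ¬ (q : ℤ) ∣ (xr q : ℤ) - (γ : SL(2, ℤ)) 1 1 ∧
      ((q : ℤ) ∣ (γ : SL(2, ℤ)) 1 0 → ¬ (q : ℤ) ∣ (xr q : ℤ) - 1) := by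
    intro q hq
    simp only [xr, dif_pos hq]
    exact Classical.choose_spec (hres q hq)
  have hS0 : ∀ q ∈ S, (q : ℕ) ≠ 0 := fun q hq ↦ (hSprime q hq).1.ne_zero
  have hSpair : Set.Pairwise (S : Set ℕ) (Function.onFun Nat.Coprime fun q ↦ q) := fun q hq q' hq' hne ↦
    (Nat.coprime_primes (hSprime q hq).1 (hSprime q' hq').1).mpr hne
  obtain ⟨x₀, hx₀⟩ := Nat.chineseRemainderOfFinset xr (fun q ↦ q) S hS0 hSpair
  set M : ℕ := ∏ q ∈ S, q with hMdef
  have hM0 : M ≠ 0 := Finset.prod_ne_zero_iff.mpr hS0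
  have hx₀M : x₀.Coprime M := by
    refine Nat.Coprime.prod_right fun q hq ↦ (Nat.coprime_comm.mp
      (((hSprime q hq).1.coprime_iff_not_dvd).mpr fun h ↦ (hxr q hq).1 ?_))
    have h1 : (q : ℤ) ∣ (x₀ : ℤ) - xr q := by
      have := (Nat.modEq_iff_dvd.mp (hx₀ q hq))
      rwa [dvd_sub_comm] at this
    have h2 : (q : ℤ) ∣ (x₀ : ℤ) := by exact_mod_cast h
    have := dvd_sub h2 h1
    rwa [sub_sub_cancel] at this
  -- Dirichlet: a prime `d₂ > |c|` in the class `x₀ (mod M)`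
  obtain ⟨d₂, hd₂c, hd₂p, hd₂x⟩ :=
    Nat.forall_exists_prime_gt_and_modEq ((γ : SL(2, ℤ)) 1 0).natAbs hM0 hx₀M
  have hd₂q : ∀ q ∈ S, (q : ℤ) ∣ (d₂ : ℤ) - xr q := by
    intro q hq
    have h1 : d₂ ≡ xr q [MOD q] :=
      (Nat.ModEq.of_dvd (Finset.dvd_prod_of_mem _ hq) hd₂x).trans (hx₀ q hq)
    have := Nat.modEq_iff_dvd.mp h1
    rwa [dvd_sub_comm] at this
  -- the two key non-divisibilities modulo `q ∈ S`
  have hd₂d : ∀ q ∈ S, ¬ (q : ℤ) ∣ (d₂ : ℤ) - (γ : SL(2, ℤ)) 1 1 := by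
    intro q hq h
    apply (hxr q hq).2.1
    rw [show (xr q : ℤ) - (γ : SL(2, ℤ)) 1 1 = ((d₂ : ℤ) - (γ : SL(2, ℤ)) 1 1) - ((d₂ : ℤ) - xr q)
      by ring]
    exact dvd_sub h (hd₂q q hq)
  have hd₂1 : ∀ q ∈ S, (q : ℤ) ∣ (γ : SL(2, ℤ)) 1 0 → ¬ (q : ℤ) ∣ (d₂ : ℤ) - 1 := by
    intro q hq hqc h
    apply (hxr q hq).2.2 hqc
    rw [show (xr q : ℤ) - 1 = ((d₂ : ℤ) - 1) - ((d₂ : ℤ) - xr q) by ring]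
    exact dvd_sub h (hd₂q q hq)
  -- `gcd(d₂, c) = 1` and Bezout
  have hcop : IsCoprime (d₂ : ℤ) ((γ : SL(2, ℤ)) 1 0) := by
    refine Literature.NumberTheory.ModularForms.OrdinaryCusps.isCoprime_natCast_of_not_dvd hd₂p fun h ↦ ?_
    exact Nat.not_dvd_of_pos_of_lt (Int.natAbs_pos.mpr hc) hd₂c (Int.natCast_dvd.mp h)
  obtain ⟨u, v, huv⟩ := hcop
  -- the matrix `γ₂ = (u, −v; c, d₂)`
  let M₂ : SL(2, ℤ) := ⟨!![u, -v; (γ : SL(2, ℤ)) 1 0, (d₂ : ℤ)], by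
    rw [Matrix.det_fin_two_of]; linear_combination huv⟩
  have hM₂ : M₂ ∈ Gamma0 N := by
    rw [Gamma0_mem]
    exact Gamma0_mem.mp γ.2
  let γ₂ : Gamma0 N := ⟨M₂, hM₂⟩
  let γ₁ : Gamma0 N := γ * γ₂⁻¹
  -- entries
  have e2_10 : ((γ₂ : SL(2, ℤ)) 1 0 : ℤ) = (γ : SL(2, ℤ)) 1 0 := rfl
  have e2_11 : ((γ₂ : SL(2, ℤ)) 1 1 : ℤ) = d₂ := rfl
  have hmat : ∀ i j : Fin 2, ((γ₁ : SL(2, ℤ)) i j : ℤ) =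
      ((γ : SL(2, ℤ)).1 * M₂.1.adjugate) i j := fun _ _ ↦ rfl
  have e1_10 : ((γ₁ : SL(2, ℤ)) 1 0 : ℤ) = (γ : SL(2, ℤ)) 1 0 * ((d₂ : ℤ) - (γ : SL(2, ℤ)) 1 1) := by
    rw [hmat]
    simp only [M₂, Matrix.adjugate_fin_two_of, Matrix.mul_apply, Fin.sum_univ_two, Matrix.of_apply,
      Matrix.cons_val', Matrix.cons_val_zero, Matrix.cons_val_one]
    ring
  have e1_11 : ((γ₁ : SL(2, ℤ)) 1 1 : ℤ) = (γ : SL(2, ℤ)) 1 0 * v + (γ : SL(2, ℤ)) 1 1 * u := by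
    rw [hmat]
    simp only [M₂, Matrix.adjugate_fin_two_of, Matrix.mul_apply, Fin.sum_univ_two, Matrix.of_apply,
      Matrix.cons_val', Matrix.cons_val_zero, Matrix.cons_val_one, neg_neg]
  -- `d₁ d₂ − d = c v (d₂ − d)`: a prime dividing `c` and `d₁ − 1` divides `d₂ − d`
  have hkey : ∀ q : ℕ, (q : ℤ) ∣ (γ : SL(2, ℤ)) 1 0 →
      (q : ℤ) ∣ ((γ : SL(2, ℤ)) 1 0 * v + (γ : SL(2, ℤ)) 1 1 * u) - 1 →
      (q : ℤ) ∣ (d₂ : ℤ) - (γ : SL(2, ℤ)) 1 1 := by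
    intro q hqc h
    have hid : (d₂ : ℤ) - (γ : SL(2, ℤ)) 1 1 =
        (γ : SL(2, ℤ)) 1 0 * (v * ((d₂ : ℤ) - (γ : SL(2, ℤ)) 1 1)) -
          (((γ : SL(2, ℤ)) 1 0 * v + (γ : SL(2, ℤ)) 1 1 * u) - 1) * d₂ := by
      linear_combination (γ : SL(2, ℤ)) 1 1 * huv
    rw [hid]
    exact dvd_sub (hqc.trans (dvd_mul_right _ _)) (h.trans (dvd_mul_right _ _))
  have hpS : p ∈ S := Finset.mem_insert_self _ _
  have hrS : ∀ r : ℕ, r.Prime → r ≠ 2 → r ∣ p - 1 → r ∈ S := fun r hr hr2 hrp ↦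
    Finset.mem_insert_of_mem (Finset.mem_erase.mpr ⟨hr2,
      Nat.mem_primeFactors.mpr ⟨hr, hrp, Nat.sub_ne_zero_of_lt hp.one_lt⟩⟩)
  refine ⟨γ₁, γ₂, (inv_mul_cancel_right γ γ₂).symm, ⟨?_, ?_, ?_⟩, ⟨?_, ?_, ?_⟩⟩
  · -- `c₁ ≠ 0`
    rw [e1_10]
    refine mul_ne_zero hc (sub_ne_zero.mpr fun h ↦ hd₂d p hpS ?_)
    rw [h, sub_self]; exact dvd_zero _
  · rw [e1_11]
    exact fun h ↦ hd₂d p hpS (hkey p hpc h)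
  · intro r hr hr2 hrp hrc
    rw [e1_11]
    rw [e1_10] at hrc
    have hrc' : (r : ℤ) ∣ (γ : SL(2, ℤ)) 1 0 := by
      rcases (Int.prime_iff_natAbs_prime.mpr (by simpa using hr)).dvd_or_dvd hrc with h | h
      · exact h
      · exact absurd h (hd₂d r (hrS r hr hr2 hrp))
    exact fun h ↦ hd₂d r (hrS r hr hr2 hrp) (hkey r hrc' h)
  · rw [e2_10]; exact hc
  · rw [e2_11]; exact hd₂1 p hpS hpc
  · intro r hr hr2 hrp hrc
    rw [e2_11]
    rw [e2_10] at hrc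
    exact hd₂1 r (hrS r hr hr2 hrp) hrc

end Splitting

/-! ### §3 `γ⁴` always satisfies the side condition at `3` -/

section PowFour

/-- In `SL₂(𝔽₃)`: if `(A⁴)₁₀ = 0` then `(A⁴)₁₁ = 1` (a finite check: upper-triangular `A` has
`A⁴ ≡ 1` on the diagonal; otherwise `(A⁴)₁₀ = c·t(t² − 2)` with `t = tr A`, and `t = 0` forces
`(A²) = −1`). [folklore] -/
theorem zmod3_pow_four (A : Matrix (Fin 2) (Fin 2) (ZMod 3)) (hA : A.det = 1)
    (h : (A ^ 4) 1 0 = 0) : (A ^ 4) 1 1 = 1 := by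
  obtain ⟨a, b, c, d, rfl⟩ : ∃ a b c d : ZMod 3, A = !![a, b; c, d] :=
    ⟨A 0 0, A 0 1, A 1 0, A 1 1, Matrix.eta_fin_two A⟩
  rw [Matrix.det_fin_two_of] at hA
  have h4 : ∀ B : Matrix (Fin 2) (Fin 2) (ZMod 3), B ^ 4 = B * B * B * B := fun B ↦ by
    rw [show (4 : ℕ) = 1 + 1 + 1 + 1 from rfl, pow_succ, pow_succ, pow_succ, pow_one]
  rw [h4] at h ⊢
  simp only [Matrix.mul_fin_two, Matrix.of_apply, Matrix.cons_val', Matrix.cons_val_zero,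
    Matrix.cons_val_one] at h ⊢
  revert a b c d
  decide

/-- **For every `γ ∈ SL(2, ℤ)`: `3 ∣ (γ⁴)₁₀ ⟹ 3 ∣ (γ⁴)₁₁ − 1`** (reduce modulo `3` and use
`zmod3_pow_four`). [folklore] -/
theorem three_dvd_pow_four_entry (γ : SL(2, ℤ)) (h : (3 : ℤ) ∣ (γ ^ 4) 1 0) :
    (3 : ℤ) ∣ (γ ^ 4) 1 1 - 1 := by
  set f := Int.castRingHom (ZMod 3) with hf
  set A : Matrix (Fin 2) (Fin 2) (ZMod 3) := f.mapMatrix (γ : Matrix (Fin 2) (Fin 2) ℤ) with hA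
  have hdet : A.det = 1 := by
    rw [hA, ← RingHom.map_det, (γ : SL(2, ℤ)).2, map_one]
  have hpow : A ^ 4 = f.mapMatrix ((γ ^ 4 : SL(2, ℤ)) : Matrix (Fin 2) (Fin 2) ℤ) := by
    rw [Matrix.SpecialLinearGroup.coe_pow, map_pow]
  have hentry : ∀ i j : Fin 2, (A ^ 4) i j = (((γ ^ 4 : SL(2, ℤ)) i j : ℤ) : ZMod 3) := by
    intro i j
    rw [hpow]
    rfl
  have h10 : (A ^ 4) 1 0 = 0 := by
    rw [hentry]
    exact (ZMod.intCast_zmod_eq_zero_iff_dvd _ 3).mpr h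
  have h11 := zmod3_pow_four A hdet h10
  rw [hentry] at h11
  have := (ZMod.intCast_eq_intCast_iff_dvd_sub 1 ((γ ^ 4 : SL(2, ℤ)) 1 1) 3).mp (by simpa using h11.symm)
  simpa using this

end PowFour

end Summit.BirchSwinnertonDyer.BirchSwinnertonDyer.Theorems.ManinFrameResidueProperRTameTwist

end
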